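import Literature.Analysis.FluidPDE.BurgersVortex
import Literature.Analysis.FluidPDE.SchefferTestFunction
import Mathlib.MeasureTheory.Constructions.HaarToSphere
import Mathlib.Analysis.InnerProductSpace.Projection.Reflection
import Mathlib.MeasureTheory.Measure.Haar.NormedSpace
import HarnessLib

/-!
# The Gaussian vortex is an exact Burgers vortex: proofs for `GaussianVortexPlanar`

Proof companion of `Literature.Analysis.FluidPDE.GaussianVortexPlanar` (imported through
`BurgersVortex`, whose `norm_sq_eq_two` is reused; definitions of the planar
Biot–Savart law `K ∗ ω`, the strained-vorticity operator `L_λ`, the Gaussian vortex `G`, the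
classical Burgers-vortex predicate `IsClassicalAsymBurgersVortex`, Gallay–Wayne's space `Y`, and
the named fact `GallayWayne2006_thm11` = Gallay–Wayne 2006, Thm. 1.1). Everything here is proved:

* planar algebra of `ξ^⊥` (`inner_perp_right`, `inner_self_perp`, `norm_perp`), the size
  `|K(z)| = (2π|z|)⁻¹` and Borel measurability of the Biot–Savart kernel;
* `G = Γ₁` is the Gauss–Weierstrass kernel of `ℝ²` at time `1` (`gaussVortexProfile_eq_heatKernel`),
  whence `∇G(z) = −(z/2)G(z)`, `ΔG = (|z|²/4 − 1)G`, `G ∈ L¹`, and **`𝓛(αG) = L₀(αG) = 0`**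
  (`strainedVorticityOperator_zero_gaussian`; Gallay–Wayne 2006, p. 2);
* **absolute convergence of the Biot–Savart integral at every point** for a bounded integrable
  density (`integrable_smul_biotSavartKernel2D`: `|x − y|⁻¹` is locally integrable in the plane,
  by polar coordinates = Mathlib `integrableOn_fun_norm_addHaar`);
* **reflection symmetry**: for a radial density the velocity `K ∗ w` is azimuthal,
  `⟪x, (K ∗ w)(x)⟫ = 0` (`inner_biotSavart2D_eq_zero_of_radial`, via the reflection across `ℝx`,
  Mathlib `Submodule.reflection`, and the change of variables `MeasureTheory.integral_comp`);
  hence **`v·∇(αG) = 0`** for `v = K ∗ (αG)` (`inner_biotSavart2D_gradient_gaussian`);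
* **the base point `λ = 0` of Gallay–Wayne's Theorem 1.1**: `αG` is a classical Burgers vortex of
  circulation `α` for every `α ∈ ℝ` (`isClassicalAsymBurgersVortex_gaussian`), and the body of
  `GallayWayne2006_thm11` holds at `lam = 0` with `ω − αG = 0 ∈ Y` (`GallayWayne2006_thm11_lamZero`).

## What is NOT here

`theorem GallayWayne2006_thm11_holds`: the asymmetric case `0 < λ ≤ λ₀` is the content of
Gallay–Wayne 2006, §§2–4 — the weighted spaces `X = L²(G⁻¹dx)`, `Y` as Hilbert spaces; the
uniform-in-`α` resolvent bounds `‖(𝓛 − αΛ)⁻¹‖_{X→Y} ≤ K₁`, `‖(𝓛 − αΛ)⁻¹𝓜‖_{Y→Y} ≤ K₂`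
(Prop. 2.1: harmonic-oscillator conjugation of `𝓛`, skew-adjointness of `Λ`, Hardy–Littlewood–
Sobolev for `K ∗ ·`); the profile `w_∞ ∈ 𝒮` with `Λw_∞ = 𝓜G` (Prop. 3.1, an ODE with
Coddington–Levinson asymptotics) giving `‖w_α‖_Y ≤ K₃|α|/(1+|α|)` (Cor. 3.3); the bilinear estimate
`‖v·∇w̃‖_X ≤ K₅‖w‖_Y‖w̃‖_Y` (Lemma 4.1: Calderón–Zygmund + Gagliardo–Nirenberg); the contraction
(Prop. 4.2) and the elliptic bootstrap to a smooth classical solution (§4, item 4). None of this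
infrastructure is in Mathlib at present; the fact stays a named fact.

## References

* Th. Gallay, C. E. Wayne, *Existence and stability of asymmetric Burgers vortices*, J. Math. Fluid
  Mech. 9 (2007) 243–261 = arXiv:math/0503353, §1 p. 2 ("`𝓛G = 0` and `v^G·∇G = 0`"), (1.3),
  (1.5), (1.7)–(1.9), Thm. 1.1; §§2–4. [GallayWayne2006]
-/

noncomputable section

open Set Function Filter Topology WithLp MeasureTheory Metric
open scoped Laplacian InnerProductSpace RealInnerProductSpace ContDiff

namespace Literature.Analysis.FluidPDE

open UnboundedOperators

/-- Local notation for the plane `ℝ² = EuclideanSpace ℝ (Fin 2)`. -/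
local notation "ℝ²" => EuclideanSpace ℝ (Fin 2)

/-! ### Planar algebra of `ξ^⊥` -/

/-- `⟪x, v^⊥⟫ = -⟪x^⊥, v⟫`: the rotation by `π/2` is skew. [folklore] -/
theorem inner_perp_right (x v : ℝ²) : ⟪x, perp v⟫ = -⟪perp x, v⟫ := by
  simp only [PiLp.inner_apply, Fin.sum_univ_two, perp_apply_zero, perp_apply_one,
    RCLike.inner_apply, conj_trivial]
  ring

/-- `⟪x, x^⊥⟫ = 0`. [folklore] -/
theorem inner_self_perp (x : ℝ²) : ⟪x, perp x⟫ = 0 := by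
  simp only [PiLp.inner_apply, Fin.sum_univ_two, perp_apply_zero, perp_apply_one,
    RCLike.inner_apply, conj_trivial]
  ring

/-- `|ξ^⊥| = |ξ|`. [folklore] -/
theorem norm_perp (z : ℝ²) : ‖perp z‖ = ‖z‖ := by
  simp only [EuclideanSpace.norm_eq, Fin.sum_univ_two, perp_apply_zero, perp_apply_one, norm_neg]
  rw [add_comm]

/-- `ξ ↦ ξ^⊥` is continuous. [folklore] -/
theorem continuous_perp : Continuous perp := by
  refine (PiLp.continuous_toLp 2 _).comp (continuous_pi fun i => ?_)
  fin_cases i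
  · exact (PiLp.continuous_apply 2 _ 1).neg
  · exact PiLp.continuous_apply 2 _ 0

/-- `|K(z)| = (2π|z|)⁻¹` (with `0⁻¹ = 0` at the origin on both sides). [folklore] -/
theorem norm_biotSavartKernel2D (z : ℝ²) :
    ‖biotSavartKernel2D z‖ = (2 * Real.pi)⁻¹ * ‖z‖⁻¹ := by
  rw [biotSavartKernel2D, norm_smul, norm_inv, Real.norm_of_nonneg (by positivity), norm_perp]
  rcases eq_or_ne ‖z‖ 0 with h | h
  · simp [h]
  · field_simp

/-- The Biot–Savart kernel is Borel measurable. [folklore] -/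
theorem measurable_biotSavartKernel2D : Measurable biotSavartKernel2D := by
  unfold biotSavartKernel2D
  exact ((measurable_const.mul (continuous_norm.measurable.pow_const 2)).inv).smul
    continuous_perp.measurable

/-! ### The Gaussian `G` as the heat kernel at time `1`; its derivatives -/

/-- `G = Γ₁`, the Gauss–Weierstrass kernel of `ℝ²` at time `1`. [folklore] -/
theorem gaussVortexProfile_eq_heatKernel : gaussVortexProfile = heatKernel (E := ℝ²) 1 := by
  funext ξ
  rw [gaussVortexProfile, heatKernel, finrank_euclideanSpace_fin]
  norm_num [Real.rpow_neg_one, neg_div]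

/-- `∂ᵥG(z) = -(G(z)/2) ⟪z, v⟫`, i.e. `∇G(z) = -(z/2) G(z)`. [folklore] -/
theorem fderiv_gaussVortexProfile_apply (z v : ℝ²) :
    fderiv ℝ gaussVortexProfile z v = -(gaussVortexProfile z / 2) * ⟪z, v⟫ := by
  rw [gaussVortexProfile_eq_heatKernel, fderiv_heatKernel_apply_eq_mul_inner, mul_one]

/-- `ΔG(z) = (|z|²/4 - 1) G(z)`. [folklore] -/
theorem laplacian_gaussVortexProfile (z : ℝ²) :
    (Δ gaussVortexProfile) z = (‖z‖ ^ 2 / 4 - 1) * gaussVortexProfile z := by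
  rw [gaussVortexProfile_eq_heatKernel, Scheffer.laplacian_heatKernel, finrank_euclideanSpace_fin]
  norm_num

/-- `G` is integrable. [folklore] -/
theorem integrable_gaussVortexProfile : Integrable gaussVortexProfile := by
  rw [gaussVortexProfile_eq_heatKernel]
  exact integrable_heatKernel_holds one_pos

/-- **`𝓛 G = 0`** (Gallay–Wayne 2006, p. 2: "it is easily verified that `𝓛G = 0`"), and more
generally `L₀(αG) = 0` for every `α`: the Gaussian solves the linear symmetric Burgers equation. [cite: GallayWayne2006, §1 (1.8)] -/
theorem strainedVorticityOperator_zero_gaussian (α : ℝ) (x : ℝ²) :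
    strainedVorticityOperator 0 (fun y => α * gaussVortexProfile y) x = 0 := by
  have hd : DifferentiableAt ℝ gaussVortexProfile x :=
    (contDiff_gaussVortexProfile (n := 1)).differentiable one_ne_zero x
  have hΔ : (Δ (fun y => α * gaussVortexProfile y)) x = α * (Δ gaussVortexProfile) x := by
    have := InnerProductSpace.laplacian_smul α
      ((contDiff_gaussVortexProfile (n := 2)).contDiffAt (x := x))
    simpa [Pi.smul_def, smul_eq_mul] using this
  rw [strainedVorticityOperator, hΔ, fderiv_const_mul hd, FunLike.coe_smul,
    Pi.smul_apply, Pi.smul_apply, smul_eq_mul, smul_eq_mul, fderiv_gaussVortexProfile_apply,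
    fderiv_gaussVortexProfile_apply, laplacian_gaussVortexProfile, norm_sq_eq_two]
  simp only [EuclideanSpace.inner_single_right, conj_trivial, one_mul]
  ring

/-! ### Absolute convergence of the planar Biot–Savart integral -/

/-- `y ↦ |x − y|⁻¹` is integrable on the unit disc about `x` (polar coordinates: `ρ · ρ⁻¹ = 1`;
Mathlib `integrableOn_fun_norm_addHaar`, translated by `y = x − w`). [folklore] -/
theorem integrableOn_inv_norm_sub_ball (x : ℝ²) :
    IntegrableOn (fun y : ℝ² => ‖x - y‖⁻¹) (ball x 1) := by
  have h0 : IntegrableOn (fun w : ℝ² => ‖w‖⁻¹) (ball (0 : ℝ²) 1) := by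
    rw [integrableOn_fun_norm_addHaar volume (f := fun y : ℝ => y⁻¹), finrank_euclideanSpace,
      Fintype.card_fin]
    simp only [Nat.add_one_sub_one, pow_one, smul_eq_mul]
    refine (integrableOn_const (C := (1 : ℝ))
      (show volume (Ioo (0 : ℝ) 1) ≠ ⊤ from measure_Ioo_lt_top.ne)).congr_fun
      (fun y hy => ?_) measurableSet_Ioo
    exact (mul_inv_cancel₀ hy.1.ne').symm
  have hT : MeasurePreserving (fun y : ℝ² => x - y) volume volume :=
    Measure.measurePreserving_sub_left volume x
  have he : MeasurableEmbedding (fun y : ℝ² => x - y) :=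
    (MeasurableEquiv.subLeft x).measurableEmbedding
  have h1 := (hT.integrableOn_comp_preimage he).2 h0
  have hset : (fun y : ℝ² => x - y) ⁻¹' ball (0 : ℝ²) 1 = ball x 1 := by
    ext y
    simp [mem_ball, dist_eq_norm, norm_sub_rev]
  rw [hset] at h1
  exact h1

/-- **Absolute convergence of the Biot–Savart integral at every point** for a bounded integrable
planar density: near `x` the kernel is `O(|x − y|⁻¹)`, locally integrable in two dimensions, and
away from `x` it is bounded (Gallay–Wayne 2006, (1.3)). [folklore] -/
theorem integrable_smul_biotSavartKernel2D {w : ℝ² → ℝ} (hw : Integrable w) {M : ℝ}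
    (hM : ∀ y, |w y| ≤ M) (x : ℝ²) :
    Integrable (fun y => w y • biotSavartKernel2D (x - y)) := by
  have hmeas : AEStronglyMeasurable (fun y => w y • biotSavartKernel2D (x - y)) volume :=
    hw.aestronglyMeasurable.smul
      (measurable_biotSavartKernel2D.comp (measurable_const.sub measurable_id)).aestronglyMeasurable
  rw [← integrableOn_univ, ← union_compl_self (ball x 1)]
  refine IntegrableOn.union ?_ ?_
  · refine Integrable.mono' ((integrableOn_inv_norm_sub_ball x).const_mul (M * (2 * Real.pi)⁻¹))
      hmeas.restrict ((ae_restrict_iff' measurableSet_ball).2 (Eventually.of_forall fun y _ => ?_))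
    rw [norm_smul, norm_biotSavartKernel2D, Real.norm_eq_abs]
    have h0 : 0 ≤ (2 * Real.pi)⁻¹ * ‖x - y‖⁻¹ := by positivity
    calc |w y| * ((2 * Real.pi)⁻¹ * ‖x - y‖⁻¹) ≤ M * ((2 * Real.pi)⁻¹ * ‖x - y‖⁻¹) :=
          mul_le_mul_of_nonneg_right (hM y) h0
      _ = M * (2 * Real.pi)⁻¹ * ‖x - y‖⁻¹ := by ring
  · refine Integrable.mono' ((hw.norm.const_mul (2 * Real.pi)⁻¹).integrableOn) hmeas.restrict
      ((ae_restrict_iff' measurableSet_ball.compl).2 (Eventually.of_forall fun y hy => ?_))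
    rw [norm_smul, norm_biotSavartKernel2D]
    have h1 : 1 ≤ ‖x - y‖ := by
      simpa [mem_ball, dist_eq_norm, norm_sub_rev] using hy
    have h2 : ‖x - y‖⁻¹ ≤ 1 := inv_le_one_of_one_le₀ h1
    calc ‖w y‖ * ((2 * Real.pi)⁻¹ * ‖x - y‖⁻¹) ≤ ‖w y‖ * ((2 * Real.pi)⁻¹ * 1) := by gcongr
      _ = (2 * Real.pi)⁻¹ * ‖w y‖ := by ring

/-! ### Radial densities have azimuthal Biot–Savart velocity -/

/-- **Reflection symmetry of the Biot–Savart law.** For a radial density `w` the velocity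
`K ∗ w` is azimuthal: `⟪x, (K ∗ w)(x)⟫ = 0` at every point where the Biot–Savart integral
converges absolutely (the reflection across the line `ℝx` preserves `w` and `|x − y|` and reverses
`⟪x, (x − y)^⊥⟫`). This is the mechanism behind `v^G · ∇G = 0` (Gallay–Wayne 2006, p. 2). [folklore] -/
theorem inner_biotSavart2D_eq_zero_of_radial {w : ℝ² → ℝ}
    (hrad : ∀ y z : ℝ², ‖y‖ = ‖z‖ → w y = w z) (x : ℝ²)
    (hint : Integrable (fun y => w y • biotSavartKernel2D (x - y))) :
    ⟪x, biotSavart2D w x⟫ = 0 := by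
  set R : ℝ² ≃ₗᵢ[ℝ] ℝ² := (ℝ ∙ x).reflection with hR
  have hRx : R x = x :=
    Submodule.reflection_mem_subspace_eq_self (Submodule.mem_span_singleton_self x)
  have hRp : R (perp x) = -perp x :=
    Submodule.reflection_mem_subspace_orthogonalComplement_eq_neg
      ((Submodule.mem_orthogonal_singleton_iff_inner_right).2 (inner_self_perp x))
  have hRR : ∀ p, R (R p) = p := Submodule.reflection_reflection (ℝ ∙ x)
  have hK : ∀ z : ℝ², ⟪x, biotSavartKernel2D z⟫ = (2 * Real.pi * ‖z‖ ^ 2)⁻¹ * ⟪x, perp z⟫ :=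
    fun z => by rw [biotSavartKernel2D, inner_smul_right]
  have hperp : ∀ z : ℝ², ⟪x, perp (R z)⟫ = -⟪x, perp z⟫ := by
    intro z
    have : ⟪perp x, R z⟫ = -⟪perp x, z⟫ := by
      rw [← R.inner_map_map (perp x) (R z), hRR, hRp, inner_neg_left]
    rw [inner_perp_right, this, inner_perp_right, neg_neg]
  have hodd : ∀ y, w (R y) * ⟪x, biotSavartKernel2D (x - R y)⟫ =
      -(w y * ⟪x, biotSavartKernel2D (x - y)⟫) := by
    intro y
    have h2 : x - R y = R (x - y) := by rw [map_sub, hRx]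
    rw [hrad _ _ (R.norm_map y), h2, hK, hK, R.norm_map, hperp]
    ring
  rw [biotSavart2D, ← integral_inner hint]
  simp_rw [inner_smul_right]
  have hI : ∫ y, w (R y) * ⟪x, biotSavartKernel2D (x - R y)⟫ =
      ∫ y, w y * ⟪x, biotSavartKernel2D (x - y)⟫ :=
    integral_comp R (fun y => w y * ⟪x, biotSavartKernel2D (x - y)⟫)
  simp_rw [hodd, integral_neg] at hI
  linarith

/-! ### The base point `λ = 0`: `αG` is an exact Burgers vortex for every `α` -/

/-- `G ≤ G(0) = (4π)⁻¹`. [folklore] -/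
theorem gaussVortexProfile_le (y : ℝ²) : gaussVortexProfile y ≤ (4 * Real.pi)⁻¹ := by
  unfold gaussVortexProfile
  have h : Real.exp (-(‖y‖ ^ 2 / 4)) ≤ 1 :=
    Real.exp_le_one_iff.2 (neg_nonpos.2 (by positivity))
  calc (4 * Real.pi)⁻¹ * Real.exp (-(‖y‖ ^ 2 / 4)) ≤ (4 * Real.pi)⁻¹ * 1 := by gcongr
    _ = (4 * Real.pi)⁻¹ := mul_one _

/-- The Biot–Savart integral of `αG` converges absolutely at every point. [folklore] -/
theorem integrable_gaussian_smul_biotSavartKernel2D (α : ℝ) (x : ℝ²) :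
    Integrable (fun y => (α * gaussVortexProfile y) • biotSavartKernel2D (x - y)) := by
  refine integrable_smul_biotSavartKernel2D (integrable_gaussVortexProfile.const_mul α)
    (M := |α| * (4 * Real.pi)⁻¹) (fun y => ?_) x
  rw [abs_mul, abs_of_pos (gaussVortexProfile_pos y)]
  exact mul_le_mul_of_nonneg_left (gaussVortexProfile_le y) (abs_nonneg α)

/-- **`v·∇(αG) = 0` for the velocity `v = K ∗ (αG)` of the Gaussian vortex** (Gallay–Wayne 2006,
p. 2: "`v^G · ∇G = 0`"): `∇G` is radial and `K ∗ G` is azimuthal. [cite: GallayWayne2006, §1 p. 2] -/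
theorem inner_biotSavart2D_gradient_gaussian (α : ℝ) (x : ℝ²) :
    ⟪biotSavart2D (fun y => α * gaussVortexProfile y) x,
      gradient (fun y => α * gaussVortexProfile y) x⟫ = 0 := by
  have hd : DifferentiableAt ℝ gaussVortexProfile x :=
    (contDiff_gaussVortexProfile (n := 1)).differentiable one_ne_zero x
  have hrad : ∀ y z : ℝ², ‖y‖ = ‖z‖ →
      α * gaussVortexProfile y = α * gaussVortexProfile z := fun y z h => by
    simp only [gaussVortexProfile, h]
  rw [real_inner_comm, gradient, InnerProductSpace.toDual_symm_apply, fderiv_const_mul hd,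
    FunLike.coe_smul, Pi.smul_apply, smul_eq_mul, fderiv_gaussVortexProfile_apply,
    inner_biotSavart2D_eq_zero_of_radial hrad x (integrable_gaussian_smul_biotSavartKernel2D α x)]
  ring

/-- **The Gaussian vortex `αG` is a classical Burgers vortex (`λ = 0`) for every circulation
`α`** (Gallay–Wayne 2006, p. 2: "it is easily verified that `𝓛G = 0` and `v^G·∇G = 0`, hence
in the symmetric case `λ = 0` the Burgers vortex `ω^α = αG`, `u^α = αv^G` is indeed a stationary
solution of (1.7) for any `α ∈ ℝ`"); here with `v = K ∗ (αG)` given by absolutely convergent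
Biot–Savart integrals and `∫ αG = α`. [cite: GallayWayne2006, §1 p. 2] -/
theorem isClassicalAsymBurgersVortex_gaussian (α : ℝ) :
    IsClassicalAsymBurgersVortex 0 α (fun x => α * gaussVortexProfile x) where
  smooth := contDiff_const.mul contDiff_gaussVortexProfile
  integrable := integrable_gaussVortexProfile.const_mul α
  kernel_integrable := integrable_gaussian_smul_biotSavartKernel2D α
  equation x := by
    rw [inner_biotSavart2D_gradient_gaussian, strainedVorticityOperator_zero_gaussian]
  circulation := by
    rw [MeasureTheory.integral_const_mul, integral_gaussVortexProfile, mul_one]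

/-- The zero function lies in `Y`. [folklore] -/
theorem memGWSobolev_zero : MemGWSobolev (fun _ : ℝ² => (0 : ℝ)) := by
  refine ⟨contDiff_const, ?_⟩
  have : (fun x : ℝ² => (gaussVortexProfile x)⁻¹ *
      ((fun _ : ℝ² => (0 : ℝ)) x ^ 2 + ‖gradient (fun _ : ℝ² => (0 : ℝ)) x‖ ^ 2)) = fun _ => 0 := by
    funext x
    simp [gradient]
  rw [this]
  exact integrable_zero _ _ _

/-- `‖0‖_Y = 0`. [folklore] -/
theorem gwSobolevNormSq_zero : gwSobolevNormSq (fun _ : ℝ² => (0 : ℝ)) = 0 := by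
  unfold gwSobolevNormSq
  simp [gradient]

/-- **Gallay–Wayne 2006, Thm. 1.1 at `λ = 0` (the base point of the perturbation argument).**
For every `α ∈ ℝ` the symmetric problem has the classical Burgers vortex `ω = αG`, with
`ω − αG = 0 ∈ Y`; this is literally the body of `GallayWayne2006_thm11` at `lam = 0`, for any
candidate constants `λ₀, K₀`. The asymmetric case `0 < λ ≤ λ₀` is the content of the paper
(§§2–4: uniform resolvent bounds for `𝓛 − αΛ`, the profile `w_∞`, contraction in `Y`, elliptic
regularity) and is not formalized here. [cite: GallayWayne2006, Thm. 1.1] -/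
theorem GallayWayne2006_thm11_lamZero (lam0 K0 α : ℝ) :
    ∃ w : ℝ² → ℝ,
      IsClassicalAsymBurgersVortex 0 α w ∧
      MemGWSobolev (fun x => w x - α * gaussVortexProfile x) ∧
      gwSobolevNormSq (fun x => w x - α * gaussVortexProfile x) ≤ K0 ^ 2 ∧
      gwSobolevNormSq (fun x => w x - α * gaussVortexProfile x) ≤
        (K0 * (0 / lam0) * (|α| / (1 + |α|))) ^ 2 := by
  refine ⟨fun x => α * gaussVortexProfile x, isClassicalAsymBurgersVortex_gaussian α, ?_, ?_, ?_⟩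
  all_goals simp only [sub_self]
  · exact memGWSobolev_zero
  · rw [gwSobolevNormSq_zero]; positivity
  · rw [gwSobolevNormSq_zero]; positivity

end Literature.Analysis.FluidPDE
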